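import Summits.Ventures.HSemireg.WedgeHankelRecurrenceGaussPositiveZerosTFAE

/-!
# Venture HSemireg — **ONE STEP OF THE SHIFTED LR ALGORITHM ON THE JACOBI MATRIX IS CHRISTOFFEL'S TRANSFORM (Rutishauser)**: for the Jacobi matrix `J_m` (diagonal `a_i`, superdiagonal `1`,
# subdiagonal `b_i`) and pivots `u_0 = a_0 − κ`, `u_n + ℓ_n = a_n − κ`, `ℓ_n u_{n−1} = b_n`, the bidiagonal factors `L` (unit lower, `ℓ_i` below) and `U` (`u_i` on, `1` above the diagonal) give
# **`L U = J_m − κ I`** and **`U L + κ I = J̃_m`**, the tridiagonal matrix with diagonal `u_i + ℓ_{i+1} + κ` (`i < m`; `u_m + κ` in the last place), superdiagonal `1`, subdiagonal `ℓ_i u_i` — and these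
# are GALANT's data (N375): `u_n = −r_n = −q_{n+1}(κ)∕q_n(κ)`, `ã_n = u_n + ℓ_{n+1} + κ`, `b̃_n = ℓ_n u_n`; so `LR(κ)` maps the recurrence of `dμ` to that of `(x − κ) dμ` (last pivot excepted)

HONEST FRAMING. Part of the Lean index of the computation cell `pub-hsemireg` (seat p10 gen 46, Sunday typer «UNIFORM-IN-n»).  Square real matrices with explicit bidiagonal ∕ tridiagonal entries
and finite sums only; no variety, no cohomology theory, no sheaf, no Ext group and no semiregularity map is constructed here; nothing here says that HC / HC_CM / HC_AV holds; no Literature fact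
(unproved `Prop`) is declared or used.  Custodian versions as in `WedgeHankelSiegelIdeal` (1/3).
SOURCES (cited).  H. Rutishauser, *Solution of eigenvalue problems with the LR-transformation*, Nat. Bur. Standards Appl. Math. Ser. 49 (1958) 47–81; J. Kautsky, G. H. Golub, *On the calculation of
Jacobi matrices*, Linear Algebra Appl. 52∕53 (1983) 439–455 (§3: LR step = Christoffel modification); W. Gautschi, *Orthogonal Polynomials: Computation and Approximation* (2004), §2.4.2–2.4.3;
D. Galant, Math. Comp. 25 (1971) 111–113; B. N. Parlett, *The Symmetric Eigenvalue Problem* (1980), Ch. 8.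
PROOF TYPED HERE.  Row `i` of `L` has the two entries `L_{i,i−1} = ℓ_i`, `L_{ii} = 1`; row `i` of `U` the entries `U_{ii} = u_i`, `U_{i,i+1} = 1`; the products are evaluated entrywise
(`lowerBidiag_mul_apply`, `upperBidiag_mul_apply`) and compared case by case; the dictionary with N375 is `u_n = −r_n` and N375 `kernel_ratio_step`.
DEDUP DISCLOSURE (`rg -n -i 'bidiag|LU_|LR step|rutishauser' Summits/Ventures/HSemireg`, 2026-09-03): N311 ∕ N338 build the Jacobi matrix `J` (same `hJ` convention, reused verbatim); no
triangular factorization.  The 5 names below: 0 hits tree-wide.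

WHAT IS IN THE TREE.  N311 `charpoly_jacobi` (the `hJ` convention); N375 `kernel_ratio_step`; Mathlib `Matrix.mul_apply`, `Finset.sum_ite_eq'`, `Fin.sum_univ_eq_sum_range`.
THIS FILE (namespace `Summit.Ventures.HSemireg.Wedge.HankelOuter` continued; CHAINED on N385 (import only); 0 definitions):
* §1151 `lowerBidiag_mul_apply`, `upperBidiag_mul_apply` (row formulas), **`jacobi_LU`** (`L U = J − κ I`), **`jacobi_UL`** (`U L + κ I = J̃`), **`jacobi_LR_galant`** (the pivots from the ratios
  `r_n = q_{n+1}(κ)∕q_n(κ)`: `u_n = −r_n` satisfies the pivot relations, and `J̃`'s data are Galant's `ã_n = a_{n+1} + r_{n+1} − r_n`, `b̃_{n+1} r_n = b_{n+1} r_{n+1}`).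
CAVEATS.  The monic (non-symmetric) Jacobi matrix of N311; the last diagonal entry of `U L + κ I` is `u_m + κ`, not `ã_m` (finite truncation).  Nothing Ext-side.  New names only.
-/

open Module Polynomial
open scoped Matrix Polynomial

namespace Summit.Ventures.HSemireg.Wedge.HankelOuter

/-! ## §1151. LR step = Christoffel transform -/

/-- **Row formula for a unit lower bidiagonal factor: `(L M)_{ij} = M_{ij} + [i ≥ 1] ℓ_i M_{i−1,j}`.** [bookkeeping; this file, §1151] -/
theorem lowerBidiag_mul_apply {m : ℕ} {ℓ : ℕ → ℝ} {L : Matrix (Fin (m + 1)) (Fin (m + 1)) ℝ}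
    (hL : ∀ i k : Fin (m + 1), L i k = if (k : ℕ) = i then 1 else if (i : ℕ) = k + 1 then ℓ i else 0) (M : Matrix (Fin (m + 1)) (Fin (m + 1)) ℝ) (i j : Fin (m + 1)) :
    (L * M) i j = M i j + if h : 0 < (i : ℕ) then ℓ i * M ⟨(i : ℕ) - 1, by omega⟩ j else 0 := by
  rw [Matrix.mul_apply]
  have hsplit : ∀ k : Fin (m + 1), L i k * M k j = (if k = i then M k j else 0) + (if (i : ℕ) = k + 1 then ℓ i * M k j else 0) := fun k => by
    rw [hL]
    by_cases h1 : (k : ℕ) = i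
    · rw [if_pos h1, if_pos (Fin.ext h1), if_neg (by omega), one_mul, add_zero]
    · rw [if_neg h1, if_neg (fun h => h1 (congrArg Fin.val h)), zero_add]
      by_cases h2 : (i : ℕ) = k + 1
      · rw [if_pos h2, if_pos h2]
      · rw [if_neg h2, if_neg h2, zero_mul]
  rw [Finset.sum_congr rfl fun k _ => hsplit k, Finset.sum_add_distrib, Finset.sum_ite_eq' Finset.univ i, if_pos (Finset.mem_univ _)]
  congr 1
  by_cases h : 0 < (i : ℕ)
  · rw [dif_pos h, Finset.sum_eq_single ⟨(i : ℕ) - 1, by omega⟩]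
    · rw [if_pos (by simp only; omega)]
    · intro k _ hk
      rw [if_neg]
      intro hik
      exact hk (Fin.ext (by simp only; omega))
    · exact fun hk => absurd (Finset.mem_univ _) hk
  · rw [dif_neg h]
    exact Finset.sum_eq_zero fun k _ => if_neg (by omega)

/-- **Row formula for an upper bidiagonal factor: `(U M)_{ij} = u_i M_{ij} + [i < m] M_{i+1,j}`.** [bookkeeping; this file, §1151] -/
theorem upperBidiag_mul_apply {m : ℕ} {u : ℕ → ℝ} {U : Matrix (Fin (m + 1)) (Fin (m + 1)) ℝ}
    (hU : ∀ i k : Fin (m + 1), U i k = if (k : ℕ) = i then u i else if (k : ℕ) = i + 1 then 1 else 0) (M : Matrix (Fin (m + 1)) (Fin (m + 1)) ℝ) (i j : Fin (m + 1)) :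
    (U * M) i j = u i * M i j + if h : (i : ℕ) + 1 < m + 1 then M ⟨(i : ℕ) + 1, h⟩ j else 0 := by
  rw [Matrix.mul_apply]
  have hsplit : ∀ k : Fin (m + 1), U i k * M k j = (if k = i then u i * M k j else 0) + (if (k : ℕ) = i + 1 then M k j else 0) := fun k => by
    rw [hU]
    by_cases h1 : (k : ℕ) = i
    · rw [if_pos h1, if_pos (Fin.ext h1), if_neg (by omega), add_zero]
    · rw [if_neg h1, if_neg (fun h => h1 (congrArg Fin.val h)), zero_add]
      by_cases h2 : (k : ℕ) = i + 1
      · rw [if_pos h2, if_pos h2, one_mul]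
      · rw [if_neg h2, if_neg h2, zero_mul]
  rw [Finset.sum_congr rfl fun k _ => hsplit k, Finset.sum_add_distrib, Finset.sum_ite_eq' Finset.univ i, if_pos (Finset.mem_univ _)]
  congr 1
  by_cases h : (i : ℕ) + 1 < m + 1
  · rw [dif_pos h, Finset.sum_eq_single ⟨(i : ℕ) + 1, h⟩]
    · rw [if_pos rfl]
    · intro k _ hk
      rw [if_neg]
      intro hik
      exact hk (Fin.ext hik)
    · exact fun hk => absurd (Finset.mem_univ _) hk
  · rw [dif_neg h]
    exact Finset.sum_eq_zero fun k _ => if_neg (by have := k.isLt; omega)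

/-- **`L U = J − κ I`** for the pivots `u_0 = a_0 − κ`, `u_n + ℓ_n = a_n − κ`, `ℓ_n u_{n−1} = b_n` (`1 ≤ n ≤ m`). [Rutishauser 1958; Parlett Ch. 8; this file, §1151] -/
theorem jacobi_LU {a b u ℓ : ℕ → ℝ} {κ : ℝ} {m : ℕ} {J L U : Matrix (Fin (m + 1)) (Fin (m + 1)) ℝ}
    (hJ : ∀ i j : Fin (m + 1), J i j = if (i : ℕ) = j then a i else if (j : ℕ) = i + 1 then 1 else if (i : ℕ) = j + 1 then b i else 0)
    (hL : ∀ i k : Fin (m + 1), L i k = if (k : ℕ) = i then 1 else if (i : ℕ) = k + 1 then ℓ i else 0)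
    (hU : ∀ i k : Fin (m + 1), U i k = if (k : ℕ) = i then u i else if (k : ℕ) = i + 1 then 1 else 0)
    (hu0 : u 0 = a 0 - κ) (hu : ∀ n, n + 1 ≤ m → u (n + 1) + ℓ (n + 1) = a (n + 1) - κ) (hl : ∀ n, n + 1 ≤ m → ℓ (n + 1) * u n = b (n + 1)) :
    L * U = J - κ • (1 : Matrix (Fin (m + 1)) (Fin (m + 1)) ℝ) := by
  ext i j
  rw [lowerBidiag_mul_apply hL, Matrix.sub_apply, Matrix.smul_apply, Matrix.one_apply, hJ, hU, smul_eq_mul]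
  have hi := i.isLt
  have hj := j.isLt
  have hone : (if i = j then (1 : ℝ) else 0) = if (i : ℕ) = j then 1 else 0 := by
    by_cases h : (i : ℕ) = j
    · rw [if_pos (Fin.ext h), if_pos h]
    · rw [if_neg (fun e => h (congrArg Fin.val e)), if_neg h]
  rw [hone]
  by_cases h0 : 0 < (i : ℕ)
  · obtain ⟨n, hn⟩ : ∃ n, (i : ℕ) = n + 1 := ⟨(i : ℕ) - 1, by omega⟩
    have hnm : n + 1 ≤ m := by omega
    rw [dif_pos h0]
    obtain ⟨k, hk⟩ : ∃ k : Fin (m + 1), (k : ℕ) = n := ⟨⟨n, by omega⟩, rfl⟩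
    have e2 : (⟨(i : ℕ) - 1, by omega⟩ : Fin (m + 1)) = k := Fin.ext (by rw [hk]; show (i : ℕ) - 1 = n; omega)
    rw [e2, hU, hk, hn]
    have hun := hu n hnm
    have hln := hl n hnm
    split_ifs <;> first | (exfalso; omega) | linarith
  · -- first row
    have hi0 : (i : ℕ) = 0 := by omega
    rw [dif_neg h0, add_zero, hi0]
    split_ifs <;> first | (exfalso; omega) | linarith

/-- **`U L + κ I = J̃`**: the tridiagonal matrix with diagonal `u_i + ℓ_{i+1} + κ` (`i < m`), `u_m + κ` (last), superdiagonal `1`, subdiagonal `ℓ_i u_i`. [Rutishauser 1958; Kautsky–Golub 1983 §3;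
this file, §1151] -/
theorem jacobi_UL {u ℓ : ℕ → ℝ} {κ : ℝ} {m : ℕ} {L U J' : Matrix (Fin (m + 1)) (Fin (m + 1)) ℝ}
    (hL : ∀ i k : Fin (m + 1), L i k = if (k : ℕ) = i then 1 else if (i : ℕ) = k + 1 then ℓ i else 0)
    (hU : ∀ i k : Fin (m + 1), U i k = if (k : ℕ) = i then u i else if (k : ℕ) = i + 1 then 1 else 0)
    (hJ' : ∀ i j : Fin (m + 1), J' i j = if (i : ℕ) = j then u i + (if (i : ℕ) + 1 ≤ m then ℓ (i + 1) else 0) + κ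
      else if (j : ℕ) = i + 1 then 1 else if (i : ℕ) = j + 1 then ℓ i * u i else 0) :
    U * L + κ • (1 : Matrix (Fin (m + 1)) (Fin (m + 1)) ℝ) = J' := by
  ext i j
  rw [Matrix.add_apply, upperBidiag_mul_apply hU, Matrix.smul_apply, Matrix.one_apply, hJ', hL, smul_eq_mul]
  have hi := i.isLt
  have hj := j.isLt
  have hone : (if i = j then (1 : ℝ) else 0) = if (i : ℕ) = j then 1 else 0 := by
    by_cases h : (i : ℕ) = j
    · rw [if_pos (Fin.ext h), if_pos h]
    · rw [if_neg (fun e => h (congrArg Fin.val e)), if_neg h]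
  rw [hone]
  by_cases hm : (i : ℕ) + 1 < m + 1
  · have eL : L ⟨(i : ℕ) + 1, hm⟩ j = if (j : ℕ) = i + 1 then 1 else if (i : ℕ) + 1 = j + 1 then ℓ (i + 1) else 0 := by rw [hL]
    rw [dif_pos hm, eL]
    split_ifs <;> first | (exfalso; omega) | ring
  · -- last row `i = m`
    rw [dif_neg hm, add_zero]
    split_ifs <;> first | (exfalso; omega) | ring

/-- **THE DICTIONARY WITH GALANT (N375)**: if `q_k(κ) ≠ 0` (`k ≤ m`), `r_k q_k(κ) = q_{k+1}(κ)`, then `u_n := −r_n`, `ℓ_{n+1} := −b_{n+1}∕r_n` are pivots (`u_0 = a_0 − κ`, `u_{n+1} + ℓ_{n+1} = a_{n+1} − κ`,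
`ℓ_{n+1} u_n = b_{n+1}`), and the transformed data read `u_n + ℓ_{n+1} + κ = a_{n+1} + r_{n+1} − r_n = ã_n`, `(ℓ_{n+1} u_{n+1}) · r_n = b_{n+1} r_{n+1}` (`= b̃_{n+1} r_n`). [Galant 1971; Kautsky–Golub
1983; this file, §1151] -/
theorem jacobi_LR_galant {q : ℕ → ℝ[X]} {a b r : ℕ → ℝ} {κ : ℝ} {m : ℕ} (hq0 : q 0 = 1) (hq1 : q 1 = Polynomial.X - C (a 0))
    (hrec : ∀ n, q (n + 2) = (Polynomial.X - C (a (n + 1))) * q (n + 1) - C (b (n + 1)) * q n) (hqκ : ∀ k, k ≤ m → (q k).eval κ ≠ 0)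
    (hr : ∀ k, k ≤ m + 1 → r k * (q k).eval κ = (q (k + 1)).eval κ) :
    (-r 0 = a 0 - κ) ∧ (∀ n, n + 1 ≤ m → -r (n + 1) + -b (n + 1) / r n = a (n + 1) - κ) ∧ (∀ n, n + 1 ≤ m → -b (n + 1) / r n * -r n = b (n + 1)) ∧
      (∀ n, n + 1 ≤ m → -r n + -b (n + 1) / r n + κ = a (n + 1) + r (n + 1) - r n) ∧ ∀ n, n + 1 ≤ m → -b (n + 1) / r n * -r (n + 1) * r n = b (n + 1) * r (n + 1) := by
  have hr0 : r 0 = κ - a 0 := by have := hr 0 (by omega); rwa [hq0, hq1, eval_one, mul_one, eval_sub, eval_X, eval_C] at this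
  have hrne : ∀ n, n + 1 ≤ m → r n ≠ 0 := fun n hn h0 => by
    have := hr n (by omega); rw [h0, zero_mul] at this; exact hqκ (n + 1) hn this.symm
  have hstar : ∀ n, n + 1 ≤ m → r n * r (n + 1) = (κ - a (n + 1)) * r n - b (n + 1) := fun n hn =>
    kernel_ratio_step hrec n (hqκ n (by omega)) (hr n (by omega)) (hr (n + 1) (by omega))
  have hkey : ∀ n, n + 1 ≤ m → -b (n + 1) / r n = a (n + 1) - κ + r (n + 1) := fun n hn => by
    rw [div_eq_iff (hrne n hn)]; linarith [hstar n hn]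
  refine ⟨by rw [hr0]; ring, fun n hn => ?_, fun n hn => ?_, fun n hn => ?_, fun n hn => ?_⟩
  · rw [hkey n hn]; ring
  · rw [show -b (n + 1) / r n * -r n = b (n + 1) * (r n / r n) by ring, div_self (hrne n hn), mul_one]
  · rw [hkey n hn]; ring
  · rw [show -b (n + 1) / r n * -r (n + 1) * r n = b (n + 1) * r (n + 1) * (r n / r n) by ring, div_self (hrne n hn), mul_one]

end Summit.Ventures.HSemireg.Wedge.HankelOuter
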